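import Summits.HubbardSuperconductivity.HubbardSuperconductivity.Theorems.GibbsMajorantMajorantTransfer

/-!
# Route `GibbsMajorant`: the support item `FloorOfCruxes` (stmt-HubbardSuperconductivity-15719)

`ThermalWindowMajorant → WindowInfraredBound → ` an eventual uniform every-ground-state floor
`a·L⁴ ≤ Re⟨ψ, Δ_d†Δ_d ψ⟩` at some `(U, δ)` (the antecedent of `UniformLROGivesSummitMatrix`).

Proof (the route's glue): take `(U, δ, θ, ε₁)` from `ThermalWindowMajorant` and `(C, ε₀, L₁)` from
`WindowInfraredBound` at `(U, δ)`; put `ε := min ε₁ (min ε₀ (θ/(4(C+1))))`; the majorant at `ε` gives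
`β`, `L₀` and, for each even `L ≥ max L₀ L₁`, a tilt `a ≥ 0` with the tilted Gibbs-trace bound;
`MajorantTransfer` (`majorantTransfer_proof`, stmt-15718) turns it into `Re⟨ψ, W_εψ⟩ ≥ (θ/2)L²`; the
window sum splits at `m = 0` into `Re⟨ψ, Δ_d†Δ_dψ⟩/L² + T_ε(ψ)` (as in route KacWindowPenalty's
`TargetImpliesSummit`; `pairStructureFactor_zero`) and
`T_ε(ψ) ≤ CεL² ≤ (θ/4)L²` by the infrared bound; hence `a := θ/4`. Scalapino, Phys. Rep. 250 (1995)
§2. Finite sums and linear arithmetic; no definition is introduced.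
-/

set_option linter.dupNamespace false

noncomputable section

open scoped ComplexOrder
open Matrix Finset Literature.MathematicalPhysics.QuantumLattice Literature.Probability.LatticeModels

namespace Summit.HubbardSuperconductivity.HubbardSuperconductivity.Theorems.GibbsMajorant

/-- **Every-ground-state floor from a window floor and a window tail** (finite `L`): if
`(θ/2)L² ≤ Re⟨ψ, W_εψ⟩` and `T_ε(ψ) ≤ σL²`, then `(θ/2 − σ)·L⁴ ≤ Re⟨ψ, Δ_dᴴΔ_d ψ⟩` — the window sum
split at `m = 0` and `Δ_d(0) = pairField`. Scalapino (1995) §2. [folklore] -/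
theorem everyGS_floor_of_windowFloor (L : ℕ) [NeZero L] {ε θ σ : ℝ}
    {ψ : Fock (Orb (FermionTorus 2 L))}
    (hfloor : θ / 2 * (L : ℝ) ^ 2 ≤
      (star ψ ⬝ᵥ (∑ m : TorusSite 2 L, if momentumNormSq L m ≤ ε ^ 2 then
        ((L : ℂ) ^ 2)⁻¹ • ((pairFieldAt dWaveFormFactor L m)ᴴ * pairFieldAt dWaveFormFactor L m)
        else 0) *ᵥ ψ).re)
    (htail : (∑ m : TorusSite 2 L, if m ≠ 0 ∧ momentumNormSq L m ≤ ε ^ 2 then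
        pairStructureFactor dWaveFormFactor L ψ m else 0) ≤ σ * (L : ℝ) ^ 2) :
    (θ / 2 - σ) * (L : ℝ) ^ 4 ≤
      (expect ((pairField dWaveFormFactor L)ᴴ * pairField dWaveFormFactor L) ψ).re := by
  classical
  have hL2 : (0 : ℝ) < (L : ℝ) ^ 2 := by
    have : (0 : ℝ) < L := by exact_mod_cast Nat.pos_of_ne_zero (NeZero.ne L)
    positivity
  -- the window penalty in the state `ψ` is the window sum of the pair structure factor
  have hwin : (star ψ ⬝ᵥ (∑ m : TorusSite 2 L, if momentumNormSq L m ≤ ε ^ 2 then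
        ((L : ℂ) ^ 2)⁻¹ • ((pairFieldAt dWaveFormFactor L m)ᴴ * pairFieldAt dWaveFormFactor L m)
        else 0) *ᵥ ψ).re =
      ∑ m : TorusSite 2 L, if momentumNormSq L m ≤ ε ^ 2 then
        pairStructureFactor dWaveFormFactor L ψ m else 0 := by
    rw [sum_mulVec, dotProduct_sum, Complex.re_sum]
    refine Finset.sum_congr rfl fun m _ => ?_
    split_ifs with hm
    · rw [smul_mulVec, dotProduct_smul, smul_eq_mul, ← star_mulVec_dotProduct_mulVec,
        pairStructureFactor_apply,
        show ((L : ℂ) ^ 2)⁻¹ = ((((L : ℝ) ^ 2)⁻¹ : ℝ) : ℂ) by push_cast; rfl, Complex.re_ofReal_mul,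
        div_eq_inv_mul]
    · rw [zero_mulVec, dotProduct_zero, Complex.zero_re]
  -- split the window sum at `m = 0` (`q_0 = 0` lies in every window)
  have hsplit : (∑ m : TorusSite 2 L, if momentumNormSq L m ≤ ε ^ 2 then
        pairStructureFactor dWaveFormFactor L ψ m else 0) =
      pairStructureFactor dWaveFormFactor L ψ 0 +
        ∑ m : TorusSite 2 L, if m ≠ 0 ∧ momentumNormSq L m ≤ ε ^ 2 then
          pairStructureFactor dWaveFormFactor L ψ m else 0 := by
    have h0 : momentumNormSq L (0 : TorusSite 2 L) ≤ ε ^ 2 := by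
      rw [(momentumNormSq_eq_zero_iff (0 : TorusSite 2 L)).2 rfl]; exact sq_nonneg ε
    have key : ∀ m : TorusSite 2 L,
        (if momentumNormSq L m ≤ ε ^ 2 then pairStructureFactor dWaveFormFactor L ψ m else 0) =
          (if m = 0 then pairStructureFactor dWaveFormFactor L ψ 0 else 0) +
            (if m ≠ 0 ∧ momentumNormSq L m ≤ ε ^ 2 then
              pairStructureFactor dWaveFormFactor L ψ m else 0) := by
      intro m
      by_cases hm : m = 0
      · subst hm
        rw [if_pos h0, if_pos rfl, if_neg (fun h => h.1 rfl), add_zero]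
      · rw [if_neg hm, zero_add]
        by_cases hc : momentumNormSq L m ≤ ε ^ 2
        · rw [if_pos hc, if_pos ⟨hm, hc⟩]
        · rw [if_neg hc, if_neg (fun h => hc h.2)]
    rw [Finset.sum_congr rfl fun m _ => key m, Finset.sum_add_distrib, Finset.sum_ite_eq']
    simp
  rw [hwin, hsplit, pairStructureFactor_zero] at hfloor
  have h2 : (θ / 2 - σ) * (L : ℝ) ^ 2 ≤
      (expect ((pairField dWaveFormFactor L)ᴴ * pairField dWaveFormFactor L) ψ).re / (L : ℝ) ^ 2 := by
    nlinarith
  rw [le_div_iff₀ hL2] at h2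
  calc (θ / 2 - σ) * (L : ℝ) ^ 4 = (θ / 2 - σ) * (L : ℝ) ^ 2 * (L : ℝ) ^ 2 := by ring
    _ ≤ _ := h2

/-- **`FloorOfCruxes` holds** (route `GibbsMajorant`, item `stmt-HubbardSuperconductivity-15719`):
`ThermalWindowMajorant → WindowInfraredBound →` the uniform every-ground-state floor
`(θ/4)·L⁴ ≤ Re⟨ψ, Δ_d†Δ_d ψ⟩` at the majorant's `(U, δ)`, for all even `L ≥ max L₀ L₁`
(`ε := min ε₁ (min ε₀ (θ/(4(C+1))))`, `MajorantTransfer`, window split, infrared tail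
`CεL² ≤ (θ/4)L²`). Scalapino (1995) §2. [folklore] -/
theorem floorOfCruxes_proof :
    Summit.HubbardSuperconductivity.HubbardSuperconductivity.Theses.GibbsMajorant.FloorOfCruxes := by
  intro hTWM hWIB
  obtain ⟨U, hU, δ, hδ, θ, ε₁, hθ, hε₁, h2⟩ := hTWM
  obtain ⟨C, ε₀, hC, hε₀, L₁, h3⟩ := hWIB U hU δ hδ
  set ε : ℝ := min ε₁ (min ε₀ (θ / (4 * (C + 1)))) with hε
  have hC1 : 0 < 4 * (C + 1) := by positivity
  have hεpos : 0 < ε := lt_min hε₁ (lt_min hε₀ (div_pos hθ hC1))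
  have hε1 : ε ∈ Set.Ioc 0 ε₁ := ⟨hεpos, min_le_left _ _⟩
  have hε0 : ε ∈ Set.Ioc 0 ε₀ := ⟨hεpos, (min_le_right _ _).trans (min_le_left _ _)⟩
  have hεθ : C * ε ≤ θ / 4 := by
    have hle : ε ≤ θ / (4 * (C + 1)) := (min_le_right _ _).trans (min_le_right _ _)
    calc C * ε ≤ C * (θ / (4 * (C + 1))) := mul_le_mul_of_nonneg_left hle hC
      _ = θ / 4 * (C / (C + 1)) := by field_simp
      _ ≤ θ / 4 * 1 := by
          refine mul_le_mul_of_nonneg_left ?_ (by positivity)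
          rw [div_le_one (by positivity)]
          linarith
      _ = θ / 4 := mul_one _
  obtain ⟨β, -, L₀, h2'⟩ := h2 ε hε1
  refine ⟨U, hU, δ, hδ, θ / 4, by positivity, max L₀ L₁, ?_⟩
  intro L _ hL hEven ψ hψ1 hGS
  obtain ⟨a, ha, hbound⟩ := h2' L (le_of_max_le_left hL) hEven
  have key := everyGS_floor_of_windowFloor L
    (majorantTransfer_proof U δ θ ε β a L hθ ha hbound ψ hψ1 hGS)
    (h3 ε hε0 L (le_of_max_le_right hL) hEven ψ hψ1 hGS)
  have hL4 : (0 : ℝ) ≤ (L : ℝ) ^ 4 := by positivity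
  calc θ / 4 * (L : ℝ) ^ 4 ≤ (θ / 2 - C * ε) * (L : ℝ) ^ 4 :=
        mul_le_mul_of_nonneg_right (by linarith) hL4
    _ ≤ _ := key

end Summit.HubbardSuperconductivity.HubbardSuperconductivity.Theorems.GibbsMajorant
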